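import Summits.QuantumFields.BalabanUV.Beta.D1BFx.RestKernelSandwichLoc
import Summits.QuantumFields.BalabanUV.Beta.CombFormSlotGaugeLetter

/-!
# Road «BF-x» — (J1) RESIDUE S7 v0.2, PART (L1-S): THE PER-SLOT SUPPORT ROWS `hSs` OF THE RAW (III′) LITERAL AT EVERY BLOCKING
# (unit `b2b-balaban-beta-d1-formalise-leaf-01`, gen 27 — head lineage of the (L1)(L2) packaging; row D1 RULING R-D1-g43-1 (M-b): «the rows that stay PER SLOT
# are the support ∕ decay rows `hSs`»; OWNER d1-p2 `J1-RESIDUE-SPEC.md` v0.2 S7 ∕ `J1-WORD-LIST.md` §5)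

HONEST DEPENDENCY (page 1, mandatory): continuum YM on T⁴ ⇐ BetaPertH ∧ nine spine estimates (0/9 proved); BetaPertH ⇐ (D1) ∧ (D4) ∧ CAP+tail;
G-an2-4 gates asym, D1 and NE2/3/4.  HONEST FRAMING (cell contract, verbatim): «discharging `BetaPertH` makes Bałaban's UV stability UNCONDITIONAL — a real
constructive-QFT result; it is NOT the continuum limit and NOT the Clay problem.»  THIS FILE: [folklore] localisation bookkeeping over OUR typed objects; it
discharges NO row of the wall by itself.  ONE HYPOTHESIS IS DISPLAYED, NOT ASSERTED: the block-scale decay of the typed one-step resolvent at each blocking,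
`hK : Decays (KInv (N := n)) CK δK` (resp. `∀ k ≥ 1, Decays (KInv (N := Lc^k)) (CK k) (δ₀ ∕ Lc^k)` across the scales — the binder shape of
`DecimationRate` :115), which the Λ-sector of the literal needs (its range is the resolvent's); the tree holds this decay only with an EXISTENTIAL rate
(`OneStepResolventKernel.decays_KInv`), so a k-UNIFORM weight rate `σS` cannot be had without displaying it — G-an2-4-class input.  0 root-level binders of
row D1 discharged (hW ∕ hR-sockets ∕ hSX-socket ∕ D1Tel ∕ D1Rep); NOT D1, NOT BetaPertH, NOT continuum, NOT Clay.

WHAT IT SAYS.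
* §1 (generic) `mass_blk_le_of_locStencil`: a local stencil family `LocStencil S C δ` has, slot by slot and block by block (`blk (S κ u) j k′`), a SUMMABLE
  `σ`-weighted mass for every `σ ≤ δ∕2`, bounded by `16·C·Zl 4 (δ∕2)²` (leaf-04 g-lineage's `RestKernelSandwichLoc.mass_le_of_biLoc` + `PackedKernelSplit.biLoc_blk`).
* §2 `locStencil_S0NOf_of_decays` (ANY tables `V H` with every-rate letters (LV)(LH) — an1's sym record AND the rooted comb tables), and its two instances
  `locStencil_JsB12CombSh0_S_zero_of_decays` (the (III′) literal) ∕ `locStencil_S0NAt_of_decays` (the road's native rooted literal, the (P-hyb) pin of OWNER g22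
  F-g22-1): under the displayed resolvent decay at rate `δK`, the RAW level-0 member
  `S⁰ = n⁴•wilsonA + (−n⁸∕2)•tabs.V + cΛ•SLam n (lamCoeffOf (KInv n) n) tabs.H` (`CombFormSlotGaugeLetter.JsB12CombSh0_S_zero`) is a local stencil family at the
  EXPLICIT rate `δK∕2`, for ANY table record `tabs` (its own letters (LV)(LH) hold at every rate) — the proof of leaf-05's `RecursiveStencilSlot.locStencil_S0NOf`
  with the existential `decays_KInv` replaced by the displayed `hK` (Wilson sector: `locStencil_wilsonA`; border sector: `tabs.hV`; Λ-sector: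
  `InterLevelTransport.locStencil_SLam` fed `BalabanStepJets.abs_lamCoeffOf_le hK` and `tabs.hH`).
* §2b `locStencil_pure_zero` ∕ `hSs_pure_zero`: the Wilson + border part ALONE is finite-range per slot, so ITS support row holds at EVERY weight rate with NO
  hypothesis — only the Λ-sector needs the displayed resolvent decay.
* §3 `hSs_raw_of_decays`: at ONE blocking, every slot `(κ,u)`, every block `(j,k′)`, every weight rate `σ ≤ δK∕4`: the END's summability row for `S⁰`
  (with the per-blocking bound `16·C·Zl 4 (δK∕4)²` — NOT k-free, and not meant to be: by R-D1-g43-1 (M-b) the k-free MASS rows are asked of the packed vertex).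
* §4 ACROSS THE SCALES, in the END's binder shape (`PackedRoadRowsMass.jet_letters_mass`'s `hSs`): `hSs_raw_scales` — under
  `hK : ∀ k ≥ 1, Decays (KInv (N := Lc^k)) (CK k) (δ₀ ∕ Lc^k)` and `σS ≤ δ₀∕4`, for ANY table records `tabs k : SymTables 3 (Lc^k)` (so `JcOfTabs`∕`tabsComp` of
  R-D1-g42-4 (3) are served), `∀ k ≥ 1, ∀ κ u j k′, Summable (p ↦ Σ_{g f} |blk ((JsB12CombSh0 (Lc := Lc^k) … (tabs k) (cΛ k) (cB k) 0).S κ u) j k′ p.1 p.2 g f| ·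
  e^{(σS∕Lc^k)(|p.1−u|₁+|p.2−u|₁)})`; `hSs_raw_scales_an1` at an1's record `symTablesAn1S2 3 (Lc^k) (cΛ k)` (= the RAW tables of an2's `JcOf`), and `hSs_S0NAt_of_decays` ∕ `hSs_S0NAt_scales` for
  the road's native ROOTED literal (the (P-hyb) pin of OWNER g22 F-g22-1).
* §5 (M-c) `mass_blk_wilsonA_le`: the Wilson sector ALONE has a k-FREE per-slot weighted block mass (`≤ 16·wBound 3·e⁴·Zl 4 (1∕2)²` for every
  `σ ≤ 1∕2`) — the ff main part meets a per-slot `hSm` row in the unit `n⁴`; the border sector does not (NOTE N-1), whence (M-b).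
NOT HERE: the k-free MASS rows (`mV`, packed-vertex form per coarse bond at `(GcombSh n 0, S⁰)` — after PART 8‴'s head displays the binder), the `S₂⁰` rows.
ABSOLUTE RULE (cell charter, verbatim): «No internally-minted statement may enter as a cited fact. Every hypothesis is either kernel-proved in this package or a
verbatim quotation of a PUBLISHED theorem with page reference. The manuscript(s) under audit are NOT citable for their own disputed steps — they are the thing
under adjudication; programme-internal (2001/route/tribunal) claims are never citable.»  No `def`, no `def … : Prop`, nothing cited as mathematics; 0 sorry.
-/

noncomputable section

open Finset
open scoped BigOperators
open Literature.MathematicalPhysics.QuantumFieldTheory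
open Literature.MathematicalPhysics.QuantumFieldTheory.Balaban1983to89
open Literature.MathematicalPhysics.QuantumFieldTheory.Balaban1983to89.Beta
open B12Sec2to5 (l1 l1_nonneg)
open ExpKernelCalculus (Site MKer Decays BiLoc Zl Zl_nonneg)
open OneStepResolventKernel (Fib KInv LocStencil)
open InterLevelTransport (SLam locStencil_SLam)
open BalabanStepJets (lamCoeffOf abs_lamCoeffOf_le)
open StepJetData (wilsonA wBound wBound_nonneg locStencil_wilsonA locStencil_add locStencil_smul)
open ExpKernelCalculus (VertexFamily)
open AffineAveraging (box toSite)
open AveragingHessianKernels (ell)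
open AveragingHessianKernelsRooted (vhSAt locStencil_vhSAt hessFFAt biLoc_hessFFAt)
open Summit.QuantumFields.BalabanUV.Beta.SymmetrisedStepJets (SymTables)
open Summit.QuantumFields.BalabanUV.Beta.SpineRooted (S0NOf S0NOf_comb S0NAt)
open Summit.QuantumFields.BalabanUV.Beta.WardLocusRecursive (SrecOf_zero)
open Summit.QuantumFields.BalabanUV.Beta.CombChartStepJets (ScombOf_eq JsComb0Of_S JsB12CombSh0_eq)
open Summit.QuantumFields.BalabanUV.Beta.SymSecondOrderTablesAn1 (symTablesAn1S2)
open Summit.QuantumFields.BalabanUV.Beta.CombChartStepJets (JsB12CombSh0)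
open Summit.QuantumFields.BalabanUV.Beta.CombFormSlotGaugeLetter (JsB12CombSh0_S_zero)
open Summit.QuantumFields.BalabanUV.Beta.D1BFx.PackedKernelSplit (blk biLoc_blk)
open Summit.QuantumFields.BalabanUV.Beta.D1BFx.RestKernelSandwichLoc (mass_le_of_biLoc)

namespace Summit.QuantumFields.BalabanUV.Beta.D1BFx.RawStencilSupportRows

/-! ## §1 Generic: a local stencil family has summable weighted block masses, slot by slot -/

/-- [folklore] **WEIGHTED BLOCK MASS OF A LOCAL STENCIL FAMILY, PER SLOT**: `LocStencil S C δ`, `0 ≤ C`, `0 < δ`, `σ ≤ δ∕2` ⊢ for every slot `(κ,u)` and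
block `(j,k′)` the `σ`-weighted mass of `blk (S κ u) j k′` centred at `u` is summable and `≤ 16·C·Zl 4 (δ∕2)²`. -/
theorem mass_blk_le_of_locStencil {S : Fin 4 → (Fin 4 → ℤ) → MKer 4 (Fib 3)} {C δ σ : ℝ} (hS : LocStencil S C δ) (hC : 0 ≤ C) (hδ : 0 < δ)
    (hσ : σ ≤ δ / 2) (κ : Fin 4) (u : Fin 4 → ℤ) (j k' : Bool) :
    (Summable fun p : Site 4 × Site 4 => ∑ g, ∑ f, |blk (S κ u) j k' p.1 p.2 g f| * Real.exp (σ * (l1 (p.1 - u) + l1 (p.2 - u)))) ∧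
      ∑' p : Site 4 × Site 4, ∑ g, ∑ f, |blk (S κ u) j k' p.1 p.2 g f| * Real.exp (σ * (l1 (p.1 - u) + l1 (p.2 - u)))
        ≤ 16 * C * Zl 4 (δ / 2) ^ 2 := by
  have h := mass_le_of_biLoc (biLoc_blk (hS κ u) j k') hC hδ hσ
  have h16 : (Fintype.card (Fin 4) : ℝ) ^ 2 = 16 := by norm_num
  rw [h16] at h
  exact h

/-! ## §2 The RAW level-0 member is a local stencil family at an EXPLICIT rate, under the displayed resolvent decay -/

section Raw

variable {n : ℕ} [NeZero n]

/-- [folklore] **THE SLOTTED LEVEL-0 SPINE `S0NOf 3 n V H cE cVH cΛ` IS A LOCAL STENCIL FAMILY AT RATE `δK∕2`, ANY TABLES** with the letters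
(LV) `∀ δ ≥ 0, ∃ C, LocStencil V C δ` and (LH) `∀ δ ≥ 0, ∃ C, VertexFamily H n C δ`, given the displayed decay `Decays (KInv (N := n)) CK δK` — leaf-05's
`RecursiveStencilSlot.locStencil_S0NOf` with the existential `decays_KInv` replaced by the displayed `hK` (Wilson `locStencil_wilsonA`, border (LV), Λ-sector
`locStencil_SLam` ∘ `abs_lamCoeffOf_le hK` ∘ (LH)).  Covers BOTH an1's symmetrised record (`tabs.V`, `tabs.H`) and the ROOTED comb tables of the road's native
literal (`vhSAt ρ`, `hessFFAt ρ` — `S0NOf_comb`). -/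
theorem locStencil_S0NOf_of_decays {V H : Fin 4 → (Fin 4 → ℤ) → MKer 4 (Fib 3)}
    (hV : ∀ δ : ℝ, 0 ≤ δ → ∃ C : ℝ, LocStencil V C δ) (hH : ∀ δ : ℝ, 0 ≤ δ → ∃ C : ℝ, VertexFamily H n C δ) (cE cVH cΛ : ℝ)
    {CK δK : ℝ} (hK : Decays (KInv (N := n) (d := 3)) CK δK) (hCK : 0 ≤ CK) (hδK : 0 < δK) :
    ∃ C : ℝ, 0 ≤ C ∧ LocStencil (S0NOf 3 n V H cE cVH cΛ) C (δK / 2) := by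
  have hδ2 : (0 : ℝ) ≤ δK / 2 := by positivity
  have h1 : LocStencil (wilsonA 3) (wBound 3 * Real.exp (4 * (δK / 2))) (δK / 2) := locStencil_wilsonA hδ2
  obtain ⟨C₂, h2⟩ := hV (δK / 2) hδ2
  have hc := abs_lamCoeffOf_le (N := n) hK hCK hδK.le
  obtain ⟨Cq, hQ⟩ := hH δK hδK.le
  have h3 := locStencil_SLam (N := n) hc hQ hδK (mul_nonneg (mul_nonneg (by positivity) hCK) (Real.exp_pos _).le)
  have hS : LocStencil (S0NOf 3 n V H cE cVH cΛ) _ (δK / 2) :=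
    locStencil_add (locStencil_add (locStencil_smul cE h1) (locStencil_smul cVH h2)) (locStencil_smul cΛ h3)
  exact ⟨_, (hS 0 0).nonneg (Sum.inl 0), hS⟩

/-- [folklore] **`S⁰ = (JsB12CombSh0 … 0).S` IS A LOCAL STENCIL FAMILY AT RATE `δK∕2`** for ANY symmetrised table record (`= S0NOf 3 n tabs.V tabs.H n⁴ (−n⁸∕2) cΛ`
by `JsB12CombSh0_eq ∕ JsComb0Of_S ∕ ScombOf_eq ∕ SrecOf_zero`), given the displayed decay of the typed resolvent. -/
theorem locStencil_JsB12CombSh0_S_zero_of_decays (hn : Odd n) (N : ℕ) (tabs : SymTables 3 n) (cΛ cB : ℝ) {CK δK : ℝ}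
    (hK : Decays (KInv (N := n) (d := 3)) CK δK) (hCK : 0 ≤ CK) (hδK : 0 < δK) :
    ∃ C : ℝ, 0 ≤ C ∧ LocStencil (JsB12CombSh0 hn N tabs cΛ cB 0).S C (δK / 2) := by
  rw [JsB12CombSh0_eq, JsComb0Of_S, ScombOf_eq, SrecOf_zero]
  exact locStencil_S0NOf_of_decays tabs.hV tabs.hH _ _ _ hK hCK hδK

/-- [folklore] **THE ROAD's NATIVE ROOTED LEVEL-0 SPINE `S0NAt 3 n (toSite r) cE cVH cΛ` IS A LOCAL STENCIL FAMILY AT RATE `δK∕2`** (any in-block root `r`, any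
numerals; rooted tables `vhSAt (toSite r)` ∕ `hessFFAt (toSite r)` with node 7aρ's every-rate letters `locStencil_vhSAt` ∕ `biLoc_hessFFAt`), given the displayed
decay — the (P-hyb) pin's raw stencil (OWNER g22 F-g22-1: `JcPin` = the `Π_bm(ctrOff)`-dressed ROOTED raw tables). -/
theorem locStencil_S0NAt_of_decays {r : Fin 4 → ℕ} (hr : r ∈ box (3 + 1) n) (cE cVH cΛ : ℝ) {CK δK : ℝ}
    (hK : Decays (KInv (N := n) (d := 3)) CK δK) (hCK : 0 ≤ CK) (hδK : 0 < δK) :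
    ∃ C : ℝ, 0 ≤ C ∧ LocStencil (S0NAt 3 n (toSite r) cE cVH cΛ) C (δK / 2) := by
  have hn1 : 1 ≤ n := Nat.one_le_iff_ne_zero.2 (NeZero.ne n)
  rw [← S0NOf_comb]
  refine locStencil_S0NOf_of_decays (fun δ hδ => ⟨_, locStencil_vhSAt hn1 hr hδ⟩)
    (fun δ hδ => ⟨2 * (ell (3 + 1) n : ℝ) ^ 2 * Real.exp (4 * ((3 : ℝ) + 1) * n * δ), fun μ y => biLoc_hessFFAt hn1 μ y hr hδ⟩) _ _ _ hK hCK hδK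

omit [NeZero n] in
/-- [folklore] **THE PURE (Wilson + border) PART OF `S⁰` IS A LOCAL STENCIL FAMILY AT EVERY RATE, UNCONDITIONALLY** (both sectors are finite-range per
slot: `locStencil_wilsonA`, `tabs.hV`): `fun κ u => n⁴ • wilsonA 3 κ u + (−n⁸∕2) • tabs.V κ u` — the Λ-free part of `JsB12CombSh0_S_zero`
(= `SpureRecOf … 0` of the record). -/
theorem locStencil_pure_zero (tabs : SymTables 3 n) {δ : ℝ} (hδ : 0 ≤ δ) :
    ∃ C : ℝ, 0 ≤ C ∧ LocStencil (fun κ u => ((n : ℝ) ^ 4) • wilsonA 3 κ u + (-((n : ℝ) ^ 8 / 2)) • tabs.V κ u) C δ := by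
  have h1 : LocStencil (wilsonA 3) (wBound 3 * Real.exp (4 * δ)) δ := locStencil_wilsonA hδ
  obtain ⟨C₂, h2⟩ := tabs.hV δ hδ
  have hS : LocStencil (fun κ u => ((n : ℝ) ^ 4) • wilsonA 3 κ u + (-((n : ℝ) ^ 8 / 2)) • tabs.V κ u) _ δ :=
    locStencil_add (locStencil_smul _ h1) (locStencil_smul _ h2)
  exact ⟨_, (hS 0 0).nonneg (Sum.inl 0), hS⟩

omit [NeZero n] in
/-- [folklore] **`hSs` FOR THE PURE PART AT EVERY WEIGHT RATE, UNCONDITIONALLY**: for every real `σ`, every slot and block, the `σ`-weighted block mass of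
the Wilson + border part of `S⁰` is summable (finite range; rate `2|σ| + 1` in `locStencil_pure_zero`). -/
theorem hSs_pure_zero (tabs : SymTables 3 n) (σ : ℝ) (κ : Fin 4) (u : Fin 4 → ℤ) (j k' : Bool) :
    Summable fun p : Site 4 × Site 4 =>
      ∑ g, ∑ f, |blk ((fun κ u => ((n : ℝ) ^ 4) • wilsonA 3 κ u + (-((n : ℝ) ^ 8 / 2)) • tabs.V κ u) κ u) j k' p.1 p.2 g f|
        * Real.exp (σ * (l1 (p.1 - u) + l1 (p.2 - u))) := by
  have hδ : (0 : ℝ) ≤ 2 * |σ| + 1 := by positivity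
  obtain ⟨C, hC0, hS⟩ := locStencil_pure_zero (n := n) tabs hδ
  have hσ : σ ≤ (2 * |σ| + 1) / 2 := by have := le_abs_self σ; linarith
  exact (mass_blk_le_of_locStencil hS hC0 (by positivity) hσ κ u j k').1

/-! ## §3 `hSs` at ONE blocking: every slot, every block, every weight rate `σ ≤ δK∕4` -/

/-- [folklore] **THE END's SUPPORT ROW `hSs` FOR THE RAW LITERAL AT ONE BLOCKING** (any table record; displayed resolvent decay at rate `δK`; weight
rate `σ ≤ δK∕4`): summable, with the per-blocking bound `16·C·Zl 4 (δK∕4)²` for the constant `C` of §2 (NOT k-free — the k-free mass rows are the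
packed-vertex rows of R-D1-g43-1 (M-b), not this one). -/
theorem hSs_raw_of_decays (hn : Odd n) (N : ℕ) (tabs : SymTables 3 n) (cΛ cB : ℝ) {CK δK : ℝ}
    (hK : Decays (KInv (N := n) (d := 3)) CK δK) (hCK : 0 ≤ CK) (hδK : 0 < δK) {σ : ℝ} (hσ : σ ≤ δK / 4)
    (κ : Fin 4) (u : Fin 4 → ℤ) (j k' : Bool) :
    ∃ C : ℝ, 0 ≤ C ∧
      (Summable fun p : Site 4 × Site 4 =>
        ∑ g, ∑ f, |blk ((JsB12CombSh0 hn N tabs cΛ cB 0).S κ u) j k' p.1 p.2 g f| * Real.exp (σ * (l1 (p.1 - u) + l1 (p.2 - u)))) ∧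
      ∑' p : Site 4 × Site 4,
        ∑ g, ∑ f, |blk ((JsB12CombSh0 hn N tabs cΛ cB 0).S κ u) j k' p.1 p.2 g f| * Real.exp (σ * (l1 (p.1 - u) + l1 (p.2 - u)))
          ≤ 16 * C * Zl 4 (δK / 2 / 2) ^ 2 := by
  obtain ⟨C, hC0, hS⟩ := locStencil_JsB12CombSh0_S_zero_of_decays hn N tabs cΛ cB hK hCK hδK
  have hσ' : σ ≤ δK / 2 / 2 := by rw [div_div]; norm_num; exact hσ
  exact ⟨C, hC0, mass_blk_le_of_locStencil hS hC0 (by positivity) hσ' κ u j k'⟩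

/-- [folklore] **THE END's SUPPORT ROW `hSs` FOR THE ROAD's NATIVE ROOTED LITERAL AT ONE BLOCKING** (any in-block root, any numerals; displayed
resolvent decay at rate `δK`; weight rate `σ ≤ δK∕4`). -/
theorem hSs_S0NAt_of_decays {r : Fin 4 → ℕ} (hr : r ∈ box (3 + 1) n) (cE cVH cΛ : ℝ) {CK δK : ℝ}
    (hK : Decays (KInv (N := n) (d := 3)) CK δK) (hCK : 0 ≤ CK) (hδK : 0 < δK) {σ : ℝ} (hσ : σ ≤ δK / 4)
    (κ : Fin 4) (u : Fin 4 → ℤ) (j k' : Bool) :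
    Summable fun p : Site 4 × Site 4 =>
      ∑ g, ∑ f, |blk (S0NAt 3 n (toSite r) cE cVH cΛ κ u) j k' p.1 p.2 g f| * Real.exp (σ * (l1 (p.1 - u) + l1 (p.2 - u))) := by
  obtain ⟨C, hC0, hS⟩ := locStencil_S0NAt_of_decays hr cE cVH cΛ hK hCK hδK
  have hσ' : σ ≤ δK / 2 / 2 := by rw [div_div]; norm_num; exact hσ
  exact (mass_blk_le_of_locStencil hS hC0 (by positivity) hσ' κ u j k').1

end Raw

/-! ## §4 Across the scales `n = Lc^k`, in the END's binder shape -/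

section Scales

variable {Lc : ℕ} [NeZero Lc]

/-- [folklore] **`hSs` FOR THE RAW LITERAL ACROSS THE SCALES, ANY TABLE RECORDS** (`PackedRoadRowsMass.jet_letters_mass`'s binder shape, at
`S (Lc^k) := (JsB12CombSh0 (Lc := Lc^k) … (tabs k) (cΛ k) (cB k) 0).S`): under the displayed block-scale decay of the typed resolvent at every scale,
`Decays (KInv (N := Lc^k)) (CK k) (δ₀ ∕ Lc^k)`, and a weight rate `σS ≤ δ₀∕4`, every slot's weighted block mass is summable at every scale `k ≥ 1`. -/
theorem hSs_raw_scales (hLc : Odd Lc) (N : ℕ) (tabs : ∀ k : ℕ, SymTables 3 (Lc ^ k)) (cΛ cB : ℕ → ℝ) {CK : ℕ → ℝ} {δ₀ σS : ℝ}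
    (hK : ∀ k : ℕ, 1 ≤ k → Decays (KInv (N := Lc ^ k) (d := 3)) (CK k) (δ₀ / ((Lc ^ k : ℕ) : ℝ))) (hCK : ∀ k, 0 ≤ CK k) (hδ₀ : 0 < δ₀)
    (hσS : σS ≤ δ₀ / 4) :
    ∀ (k : ℕ), 1 ≤ k → ∀ (κ : Fin 4) (u : Fin 4 → ℤ) (j k' : Bool), Summable fun p : Site 4 × Site 4 =>
      ∑ g, ∑ f, |blk ((JsB12CombSh0 (Lc := Lc ^ k) hLc.pow N (tabs k) (cΛ k) (cB k) 0).S κ u) j k' p.1 p.2 g f|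
        * Real.exp (σS / ((Lc ^ k : ℕ) : ℝ) * (l1 (p.1 - u) + l1 (p.2 - u))) := by
  intro k hk κ u j k'
  have hn : (0 : ℝ) < ((Lc ^ k : ℕ) : ℝ) := by exact_mod_cast Nat.pos_of_ne_zero (NeZero.ne (Lc ^ k))
  have hδK : 0 < δ₀ / ((Lc ^ k : ℕ) : ℝ) := div_pos hδ₀ hn
  have hσ : σS / ((Lc ^ k : ℕ) : ℝ) ≤ δ₀ / ((Lc ^ k : ℕ) : ℝ) / 4 := by
    rw [div_right_comm]
    exact div_le_div_of_nonneg_right hσS hn.le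
  obtain ⟨C, -, h, -⟩ := hSs_raw_of_decays (n := Lc ^ k) hLc.pow N (tabs k) (cΛ k) (cB k) (hK k hk) (hCK k) hδK hσ κ u j k'
  exact h

/-- [folklore] **`hSs` FOR THE RAW LITERAL OF RECORD ACROSS THE SCALES** (an1's `symTablesAn1S2 3 (Lc^k) (cΛ k)` — the RAW tables of an2's `JcOf`). -/
theorem hSs_raw_scales_an1 (hLc : Odd Lc) (N : ℕ) (cΛ cB : ℕ → ℝ) {CK : ℕ → ℝ} {δ₀ σS : ℝ}
    (hK : ∀ k : ℕ, 1 ≤ k → Decays (KInv (N := Lc ^ k) (d := 3)) (CK k) (δ₀ / ((Lc ^ k : ℕ) : ℝ))) (hCK : ∀ k, 0 ≤ CK k) (hδ₀ : 0 < δ₀)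
    (hσS : σS ≤ δ₀ / 4) :
    ∀ (k : ℕ), 1 ≤ k → ∀ (κ : Fin 4) (u : Fin 4 → ℤ) (j k' : Bool), Summable fun p : Site 4 × Site 4 =>
      ∑ g, ∑ f, |blk ((JsB12CombSh0 (Lc := Lc ^ k) hLc.pow N (symTablesAn1S2 3 (Lc ^ k) (cΛ k)) (cΛ k) (cB k) 0).S κ u) j k' p.1 p.2 g f|
        * Real.exp (σS / ((Lc ^ k : ℕ) : ℝ) * (l1 (p.1 - u) + l1 (p.2 - u))) :=
  hSs_raw_scales hLc N (fun k => symTablesAn1S2 3 (Lc ^ k) (cΛ k)) cΛ cB hK hCK hδ₀ hσS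

/-- [folklore] **`hSs` FOR THE ROAD's NATIVE ROOTED LITERAL ACROSS THE SCALES** (the (P-hyb) pin: `S (Lc^k) := S0NAt 3 (Lc^k) (toSite (r k)) (cE k) (cVH k) (cΛ k)`,
roots `r k ∈ box 4 (Lc^k)`, numerals free): under the displayed block-scale decay at every scale and `σS ≤ δ₀∕4`. -/
theorem hSs_S0NAt_scales (r : ℕ → Fin 4 → ℕ) (hr : ∀ k : ℕ, 1 ≤ k → r k ∈ box (3 + 1) (Lc ^ k)) (cE cVH cΛ : ℕ → ℝ) {CK : ℕ → ℝ} {δ₀ σS : ℝ}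
    (hK : ∀ k : ℕ, 1 ≤ k → Decays (KInv (N := Lc ^ k) (d := 3)) (CK k) (δ₀ / ((Lc ^ k : ℕ) : ℝ))) (hCK : ∀ k, 0 ≤ CK k) (hδ₀ : 0 < δ₀)
    (hσS : σS ≤ δ₀ / 4) :
    ∀ (k : ℕ), 1 ≤ k → ∀ (κ : Fin 4) (u : Fin 4 → ℤ) (j k' : Bool), Summable fun p : Site 4 × Site 4 =>
      ∑ g, ∑ f, |blk (S0NAt 3 (Lc ^ k) (toSite (r k)) (cE k) (cVH k) (cΛ k) κ u) j k' p.1 p.2 g f|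
        * Real.exp (σS / ((Lc ^ k : ℕ) : ℝ) * (l1 (p.1 - u) + l1 (p.2 - u))) := by
  intro k hk κ u j k'
  have hn : (0 : ℝ) < ((Lc ^ k : ℕ) : ℝ) := by exact_mod_cast Nat.pos_of_ne_zero (NeZero.ne (Lc ^ k))
  have hδK : 0 < δ₀ / ((Lc ^ k : ℕ) : ℝ) := div_pos hδ₀ hn
  have hσ : σS / ((Lc ^ k : ℕ) : ℝ) ≤ δ₀ / ((Lc ^ k : ℕ) : ℝ) / 4 := by
    rw [div_right_comm]
    exact div_le_div_of_nonneg_right hσS hn.le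
  exact hSs_S0NAt_of_decays (n := Lc ^ k) (hr k hk) (cE k) (cVH k) (cΛ k) (hK k hk) (hCK k) hδK hσ κ u j k'

end Scales

/-! ## §5 (M-c), Wilson sector: the ff MAIN sector has a k-FREE per-slot mass at every bounded weight rate, unconditionally -/

section Wilson

/-- [folklore] **THE WILSON SECTOR's PER-SLOT WEIGHTED BLOCK MASS IS k-FREE** (finite star; `locStencil_wilsonA` at the n-free rate `1`): for every weight
rate `σ ≤ 1∕2`, every slot and block, the `σ`-weighted mass of `blk (wilsonA 3 κ u) j k′` is summable and `≤ 16·(wBound 3·e⁴)·Zl 4 (1∕2)²` — so the unit-`n⁴`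
Wilson part `n⁴ • wilsonA` of `S⁰` meets a per-slot `hSm`-type row with the k-free table `n⁴·16·wBound 3·e⁴·Zl 4 (1∕2)²` at every scale (the END's rate
`σS∕Lc^k ≤ σS ≤ 1∕2`). The border (V) sector has NO such k-free per-slot row (leaf-01 g27 NOTE N-1: spine-root slots grow like `n`), whence (M-b). -/
theorem mass_blk_wilsonA_le {σ : ℝ} (hσ : σ ≤ 1 / 2) (κ : Fin 4) (u : Fin 4 → ℤ) (j k' : Bool) :
    (Summable fun p : Site 4 × Site 4 => ∑ g, ∑ f, |blk (wilsonA 3 κ u) j k' p.1 p.2 g f| * Real.exp (σ * (l1 (p.1 - u) + l1 (p.2 - u)))) ∧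
      ∑' p : Site 4 × Site 4, ∑ g, ∑ f, |blk (wilsonA 3 κ u) j k' p.1 p.2 g f| * Real.exp (σ * (l1 (p.1 - u) + l1 (p.2 - u)))
        ≤ 16 * (wBound 3 * Real.exp (4 * 1)) * Zl 4 (1 / 2) ^ 2 := by
  have h1 : LocStencil (wilsonA 3) (wBound 3 * Real.exp (4 * 1)) 1 := locStencil_wilsonA zero_le_one
  exact mass_blk_le_of_locStencil h1 (mul_nonneg (wBound_nonneg 3) (Real.exp_pos _).le) one_pos hσ κ u j k'

end Wilson


end Summit.QuantumFields.BalabanUV.Beta.D1BFx.RawStencilSupportRows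

end
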